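import Summits.Ventures.HodgeRepro2.A2HodgeType
import Summits.Ventures.HodgeRepro2.A2HermitianFromAlternating

/-!
# Lemma A4.2.3 ∘ Lange Lemma 1.2.10 — «J-invariant alternating forms are exactly the imaginary parts of hermitian forms»

Blind cell pub-hodge-repro2, seat p6 (sub-claim A2 annex, Tier 4). Imports my rows 2 (`A2HodgeType`: `Jstar E v w :=
E (I • v) (I • w)` on complex-valued forms and Lemma A4.2.3's eigen-decomposition `Jstar_eq_self_iff`) and 73
(`A2HermitianFromAlternating`: Lange Lemma 1.2.10).

THE PROSE (route/T4-A2-p6.md): Lemma A4.2.3 «type (1,1) ⟺ invariance under the complex structure» and Prop. A4.2.4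
Step 1 / Step 2, which pass from a class of type (1,1), through Lange Prop. 1.2.9 (E22: «E satisfies (ii)», i.e.
E(iv, iw) = E(v, w)) and Lemma 1.2.10 (E23), to a hermitian form H with E = Im H.

WHAT IS PROVED HERE (V any complex vector space):
* `complexify E` — a real form read as a complex-valued one; `jstar_complexify_eq_iff` — row 2's `Jstar` fixes
  `complexify E` iff `E(iv, iw) = E(v, w)` for all `v, w` (row 73's `invar`).
* `IsRealAlt E` — a real bilinear alternating form (row 73's `IsRiemannAlt` without the invariance);
  `isRiemannAlt_iff` — `IsRiemannAlt E ↔ IsRealAlt E ∧ Jstar (complexify E) = complexify E`.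
* **`exists_isHermitian_altOfHerm_eq_iff`** — for a real alternating form `E`: `E = Im H` for some hermitian `H`
  iff `Jstar (complexify E) = complexify E` (Lemma 1.2.10 in the form used by Step 1 → Step 2).
* **`exists_isHermitian_altOfHerm_eq_iff_of_decomposition`** — with Lemma A4.2.3's decomposition
  `complexify E = Ep + Em`, `Jstar Ep = Ep`, `Jstar Em = −Em` (the (1,1)-part and the (2,0)+(0,2)-part): `E = Im H`
  for some hermitian `H` iff `Em = 0`, i.e. iff `E` is of type (1,1).
What stays prose: the decomposition of a class into its (2,0), (1,1), (0,2) parts (Lange Prop. 1.2.8, a cited input of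
row 2) and the lattice.
§8(d) declaration: uses an L-value-free non-vanishing device: NO.
-/

namespace Summit.Ventures.HodgeRepro2.A2HermitianTypeOneOne

open Summit.Ventures.HodgeRepro2.A2HodgeType
open Summit.Ventures.HodgeRepro2.A2HermitianFromAlternating
open Complex

/-- A real-valued form read as a complex-valued one (row 2's forms are complex-valued). -/
def complexify {V : Type*} (E : V → V → ℝ) : V → V → ℂ := fun v w => ((E v w : ℝ) : ℂ)

/-- `complexify` evaluates to the real number, coerced. -/
@[simp] lemma complexify_apply {V : Type*} (E : V → V → ℝ) (v w : V) : complexify E v w = ((E v w : ℝ) : ℂ) := rfl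

variable {V : Type*} [AddCommGroup V] [Module ℂ V]

/-- Row 2's `Jstar` fixes `complexify E` iff `E(iv, iw) = E(v, w)` for all `v, w`. -/
lemma jstar_complexify_eq_iff (E : V → V → ℝ) :
    Jstar (complexify E) = complexify E ↔ ∀ v w, E (I • v) (I • w) = E v w := by
  constructor
  · intro h v w
    have := congrFun (congrFun h v) w
    simp only [Jstar, complexify_apply] at this
    exact_mod_cast this
  · intro h
    funext v w
    simp only [Jstar, complexify_apply, h v w]

/-- A real bilinear alternating form on `V` (the first five fields of row 73's `IsRiemannAlt`). -/
structure IsRealAlt (E : V → V → ℝ) : Prop where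
  /-- additivity in the first variable -/
  add_left : ∀ v v' w, E (v + v') w = E v w + E v' w
  /-- ℝ-homogeneity in the first variable -/
  smul_left : ∀ (r : ℝ) v w, E (r • v) w = r * E v w
  /-- additivity in the second variable -/
  add_right : ∀ v w w', E v (w + w') = E v w + E v w'
  /-- ℝ-homogeneity in the second variable -/
  smul_right : ∀ (r : ℝ) v w, E v (r • w) = r * E v w
  /-- alternating -/
  alt : ∀ v, E v v = 0

/-- `IsRiemannAlt E ↔ IsRealAlt E ∧ Jstar (complexify E) = complexify E`. -/
theorem isRiemannAlt_iff (E : V → V → ℝ) :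
    IsRiemannAlt E ↔ IsRealAlt E ∧ Jstar (complexify E) = complexify E := by
  constructor
  · intro h
    exact ⟨⟨h.add_left, h.smul_left, h.add_right, h.smul_right, h.alt⟩,
      (jstar_complexify_eq_iff E).mpr h.invar⟩
  · rintro ⟨h, hJ⟩
    exact ⟨h.add_left, h.smul_left, h.add_right, h.smul_right, h.alt, (jstar_complexify_eq_iff E).mp hJ⟩

/-- **Lemma 1.2.10 in the form used by Prop. A4.2.4**: a real alternating form is the imaginary part of a hermitian
form iff it is invariant under the complex structure (`Jstar`). -/
theorem exists_isHermitian_altOfHerm_eq_iff {E : V → V → ℝ} (hE : IsRealAlt E) :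
    (∃ H : V → V → ℂ, IsHermitian H ∧ altOfHerm H = E) ↔ Jstar (complexify E) = complexify E := by
  constructor
  · rintro ⟨H, hH, rfl⟩
    exact (jstar_complexify_eq_iff _).mpr (isRiemannAlt_altOfHerm hH).invar
  · intro hJ
    have hR : IsRiemannAlt E := (isRiemannAlt_iff E).mpr ⟨hE, hJ⟩
    exact ⟨hermOfAlt E, isHermitian_hermOfAlt hR, altOfHerm_hermOfAlt E⟩

/-- **Lemma A4.2.3 ∘ Lemma 1.2.10**: with the decomposition `complexify E = Ep + Em` into the `Jstar`-invariant part
(type (1,1)) and the anti-invariant part (types (2,0) + (0,2)), a real alternating `E` is `Im H` for a hermitian `H`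
iff its (2,0) + (0,2) part vanishes. -/
theorem exists_isHermitian_altOfHerm_eq_iff_of_decomposition {E : V → V → ℝ} (hE : IsRealAlt E)
    {Ep Em : V → V → ℂ} (hsum : complexify E = Ep + Em) (hp : Jstar Ep = Ep) (hm : Jstar Em = -Em) :
    (∃ H : V → V → ℂ, IsHermitian H ∧ altOfHerm H = E) ↔ Em = 0 := by
  rw [exists_isHermitian_altOfHerm_eq_iff hE]
  exact Jstar_eq_self_iff hsum hp hm

end Summit.Ventures.HodgeRepro2.A2HermitianTypeOneOne
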